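import Summits.AnomalousDissipation.AnomalousDissipation.Theorems.MarginalStabilityChainStrainedLayerLawClockLaminar
import HarnessLib

/-!
# Crux `MarginalStabilityChain.StrainedLayerLaw` (stmt-AnomalousDissipation-3007), line `FirstLemmasR2K4`
# (log-enstrophy clock + Nash roundness): energy relaminarisation of the tailed class — tools A

Support file (`--supports stmt-AnomalousDissipation-3007`; registered sub-goal `energyRelam_pressure`, the first
tool file of the registered sub-goal `energy_relaminarisation` of line `FirstLemmasR2K4`, lead c7). Elementary
slice facts behind the GLOBAL NONLINEAR ENERGY STABILITY of the Burgers layer `U_B = burgersLayerProfile 1 ν 1`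
in the tailed class (the energy method of Serrin / Joseph for the strained shear layer, i.e. Majda–Bertozzi 2002,
§3.1.1 basic energy identity for the perturbation `(a, b) = (u − U_B, v)`), all proved:

* `energyRelam_shear_decay`: a profile `g → ±½` at `±∞` with `|g′| ≤ c e^{−r|y|}` is exponentially close to the
  step `±½` (fundamental theorem of calculus on half-lines);
* `energyRelam_profile`: bookkeeping of `U_B`, `U_B′ = burgersLayerProfileD 1 ν 1`, `U_B″ = burgersLayerProfileDD 1 ν 1`
  (`|U_B| ≤ ½`, `0 ≤ U_B′`, `U_B′² ≤ 1/(2πν)`, `νU_B″ = −yU_B′`, Gaussian tails in exponential dress);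
* `energyRelam_perturbation`: for a tailed slice `(f, g)` (`SliceTails C k f g`, far field `f → ±½`) the
  perturbation `a = f − U_B` is `C²`, its slice derivatives are `∂ₓf`, `∂_yf − U_B′`, `Δf − U_B″`, and
  `a, ∂_ya, Δa` decay like `e^{−k′|y|}`, `k′ = min k κ`, `κ = (2ν)^{-1/2}`;
* `energyRelam_pressure` (registered): the pressure of a tailed classical solution grows at most quadratically
  across the layer, `∂_yp` at most linearly, and `∂ₓp` decays like `(1 + |y|)²e^{−k|y|}` (read off the momentum
  equations, the bookkeeping of `stub_strainWorkIdentity_slice` made importable).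

References: D. D. Joseph, *Stability of Fluid Motions I*, Springer 1976, §2–§4 (energy method); J. Serrin, Arch.
Rational Mech. Anal. 3 (1959) 1–13; A. J. Majda, A. L. Bertozzi, *Vorticity and Incompressible Flow*, CUP 2002,
§3.1.1 (basic energy identity on the period strip).
-/

-- `Summit.<Summit>.<Problem>` is the tree's mandated summit-side namespace (CONVENTIONS §2); for this
-- single-conjunct summit the two coincide, so the duplicate is deliberate.
set_option linter.dupNamespace false

noncomputable section

open scoped Topology ENNReal
open Filter Set Function MeasureTheory

namespace Summit.AnomalousDissipation.AnomalousDissipation.Theorems.StrainedLayerLaw.LogEnstrophyClock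

open Literature.Analysis.FluidPDE Literature.Analysis.FluidPDE.StretchedLayer
open Summit.AnomalousDissipation.AnomalousDissipation.Theses.MarginalStabilityChain
open Summit.AnomalousDissipation.AnomalousDissipation.Theorems.StrainedLayerLaw.StrainWorkSumRule

/-! ## Shear profiles are exponentially close to the step -/

/-- **Shear decay.** If `g : ℝ → ℝ` has derivative `g′` with `|g′(y)| ≤ c e^{−r|y|}` (`r > 0`, `g′` continuous) and
`g → ½` at `+∞`, `g → −½` at `−∞`, then `|g(y) − (±½)| ≤ (c/r) e^{−r|y|}` (sign of `y`): by the fundamental theorem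
of calculus on half-lines, `½ − g(y) = ∫_{(y,∞)} g′` for `y ≥ 0` and `g(y) + ½ = ∫_{(−∞,y]} g′` for `y < 0`.
[folklore] -/
theorem energyRelam_shear_decay {g g' : ℝ → ℝ} {c r : ℝ} (hr : 0 < r)
    (hg : ∀ y, HasDerivAt g (g' y) y) (hg'c : Continuous g')
    (hle : ∀ y, |g' y| ≤ c * Real.exp (-r * |y|))
    (htop : Tendsto g atTop (𝓝 (1 / 2))) (hbot : Tendsto g atBot (𝓝 (-(1 / 2)))) (y : ℝ) :
    |g y - (if 0 ≤ y then 1 / 2 else -(1 / 2))| ≤ c / r * Real.exp (-r * |y|) := by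
  rcases le_or_gt 0 y with hy | hy
  · -- upper half-line
    rw [if_pos hy, abs_of_nonneg hy]
    have hbi : IntegrableOn (fun η => c * Real.exp (-r * η)) (Ioi y) :=
      (integrableOn_exp_mul_Ioi (neg_lt_zero.2 hr) y).const_mul c
    have hae : ∀ᵐ η ∂(volume.restrict (Ioi y)), ‖g' η‖ ≤ c * Real.exp (-r * η) := by
      filter_upwards [ae_restrict_mem measurableSet_Ioi] with η hη
      rw [Real.norm_eq_abs]
      have h1 := hle η
      rwa [abs_of_nonneg (hy.trans (le_of_lt hη))] at h1
    have hgi : IntegrableOn g' (Ioi y) := hbi.mono' hg'c.aestronglyMeasurable hae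
    have hFTC : ∫ η in Ioi y, g' η = 1 / 2 - g y :=
      integral_Ioi_of_hasDerivAt_of_tendsto' (fun η _ => hg η) hgi htop
    have hval : ∫ η in Ioi y, c * Real.exp (-r * η) = c / r * Real.exp (-r * y) := by
      rw [integral_const_mul, integral_exp_mul_Ioi (neg_lt_zero.2 hr) y]
      field_simp
    have h2 := norm_integral_le_of_norm_le hbi hae
    rw [hFTC, hval, Real.norm_eq_abs] at h2
    rwa [abs_sub_comm]
  · -- lower half-line
    rw [if_neg (not_le.2 hy), abs_of_neg hy, sub_neg_eq_add]
    have hbi : IntegrableOn (fun η => c * Real.exp (r * η)) (Iic y) :=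
      (integrableOn_exp_mul_Iic hr y).const_mul c
    have hae : ∀ᵐ η ∂(volume.restrict (Iic y)), ‖g' η‖ ≤ c * Real.exp (r * η) := by
      filter_upwards [ae_restrict_mem measurableSet_Iic] with η hη
      rw [Real.norm_eq_abs]
      have h1 := hle η
      rwa [abs_of_neg (lt_of_le_of_lt hη hy), show -r * -η = r * η by ring] at h1
    have hgi : IntegrableOn g' (Iic y) := hbi.mono' hg'c.aestronglyMeasurable hae
    have hFTC : ∫ η in Iic y, g' η = g y - -(1 / 2) :=
      integral_Iic_of_hasDerivAt_of_tendsto' (fun η _ => hg η) hgi hbot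
    have hval : ∫ η in Iic y, c * Real.exp (r * η) = c / r * Real.exp (-r * -y) := by
      rw [integral_const_mul, integral_exp_mul_Iic hr y, show -r * -y = r * y by ring]
      field_simp
    have h2 := norm_integral_le_of_norm_le hbi hae
    rw [hFTC, hval, Real.norm_eq_abs, sub_neg_eq_add] at h2
    exact h2

/-! ## The Burgers layer profile at `γ = ΔU = 1` -/

/-- **Bookkeeping of the laminar profile** `U_B = burgersLayerProfile 1 ν 1` (`ν > 0`, `κ = burgersLayerRate 1 ν`):
`κ > 0`, `|U_B| ≤ ½`, `0 ≤ U_B′`, `U_B′² ≤ 1/(2πν)` (`U_B′² = e^{−y²/ν}/(2πν)`), the profile equation `νU_B″ = −yU_B′`,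
and one constant `c_B ≥ 1` with `U_B′ ≤ c_B`, `U_B′ ≤ c_B e^{−κ|y|}`, `|U_B″| ≤ c_B e^{−κ|y|}`,
`|U_B − (±½)| ≤ c_B e^{−κ|y|}` (Gaussian tails of `StretchedLayerNSBurgersTails`, `energyRelam_shear_decay`). [folklore] -/
theorem energyRelam_profile {ν : ℝ} (hν : 0 < ν) :
    0 < burgersLayerRate 1 ν ∧
    (∀ y, |burgersLayerProfile 1 ν 1 y| ≤ 1 / 2) ∧
    (∀ y, 0 ≤ burgersLayerProfileD 1 ν 1 y) ∧
    (∀ y, burgersLayerProfileD 1 ν 1 y ^ 2 ≤ 1 / (2 * Real.pi * ν)) ∧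
    (∀ y, ν * burgersLayerProfileDD 1 ν 1 y = -(y * burgersLayerProfileD 1 ν 1 y)) ∧
    ∃ cB : ℝ, 1 ≤ cB ∧ ∀ y,
      burgersLayerProfileD 1 ν 1 y ≤ cB ∧
      burgersLayerProfileD 1 ν 1 y ≤ cB * Real.exp (-burgersLayerRate 1 ν * |y|) ∧
      |burgersLayerProfileDD 1 ν 1 y| ≤ cB * Real.exp (-burgersLayerRate 1 ν * |y|) ∧
      |burgersLayerProfile 1 ν 1 y - (if 0 ≤ y then 1 / 2 else -(1 / 2))| ≤
        cB * Real.exp (-burgersLayerRate 1 ν * |y|) := by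
  set κ := burgersLayerRate 1 ν with hκ_def
  have hκ : 0 < κ := burgersLayerRate_pos one_pos hν
  have h01 : (0:ℝ) ≤ 1 := zero_le_one
  have hD0 : ∀ y, 0 ≤ burgersLayerProfileD 1 ν 1 y := burgersLayerProfileD_nonneg 1 ν h01
  -- the four constants
  set c1 : ℝ := 1 / Real.sqrt Real.pi * κ with hc1
  set c2 : ℝ := 1 / Real.sqrt Real.pi * κ * Real.exp (1 / 4) with hc2
  set c3 : ℝ := 2 * κ ^ 2 * (1 / Real.sqrt Real.pi) * Real.exp 1 with hc3
  have hc10 : 0 ≤ c1 := by positivity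
  have hc20 : 0 ≤ c2 := by positivity
  have hc30 : 0 ≤ c3 := by positivity
  have hsup : ∀ y, burgersLayerProfileD 1 ν 1 y ≤ c1 := fun y => burgersLayerProfileD_le h01 y
  have htail : ∀ y, burgersLayerProfileD 1 ν 1 y ≤ c2 * Real.exp (-κ * |y|) := fun y =>
    burgersLayerProfileD_le_exp h01 y
  have htail2 : ∀ y, |burgersLayerProfileDD 1 ν 1 y| ≤ c3 * Real.exp (-κ * |y|) := fun y =>
    abs_burgersLayerProfileDD_le_exp h01 y
  have hcont : Continuous (burgersLayerProfileD 1 ν 1) := by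
    unfold burgersLayerProfileD; fun_prop
  have hstep : ∀ y, |burgersLayerProfile 1 ν 1 y - (if 0 ≤ y then 1 / 2 else -(1 / 2))| ≤
      c2 / κ * Real.exp (-κ * |y|) :=
    energyRelam_shear_decay hκ (hasDerivAt_burgersLayerProfile' 1 ν 1) hcont
      (fun y => by rw [abs_of_nonneg (hD0 y)]; exact htail y)
      (tendsto_burgersLayerProfile_atTop one_pos hν 1) (tendsto_burgersLayerProfile_atBot one_pos hν 1)
  have hc40 : 0 ≤ c2 / κ := by positivity
  refine ⟨hκ, abs_burgersLayerProfile_le one_pos hν h01, hD0, fun y => ?_, fun y => ?_,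
    1 + c1 + c2 + c3 + c2 / κ, by linarith, fun y => ⟨?_, ?_, ?_, ?_⟩⟩
  · rw [burgersLayerProfileD_sq (by positivity : (0:ℝ) ≤ 1 / (2 * ν))]
    have he : Real.exp (-(1 / ν) * y ^ 2) ≤ 1 := by
      refine Real.exp_le_one_iff.2 ?_
      have h1 : 0 ≤ 1 / ν * y ^ 2 := by positivity
      linarith
    have hc : 0 ≤ 1 ^ 2 / Real.pi * (1 / (2 * ν)) := by positivity
    calc 1 ^ 2 / Real.pi * (1 / (2 * ν)) * Real.exp (-(1 / ν) * y ^ 2)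
        ≤ 1 ^ 2 / Real.pi * (1 / (2 * ν)) * 1 := mul_le_mul_of_nonneg_left he hc
      _ = 1 / (2 * Real.pi * ν) := by ring
  · have h := burgersLayerProfile_ode 1 ν 1 y
    rw [one_mul] at h
    exact h
  · have := hsup y
    linarith
  · have he := Real.exp_pos (-κ * |y|)
    have := htail y
    nlinarith
  · have he := Real.exp_pos (-κ * |y|)
    have := htail2 y
    nlinarith
  · have he := Real.exp_pos (-κ * |y|)
    have := hstep y
    nlinarith

/-! ## The perturbation of a tailed slice about the laminar profile -/

/-- **The perturbation `a = f − U_B` of a tailed shear slice.** For a `C²` slice `f` with shear tails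
`SliceTails C k f g` (`k > 0`) and the shear far field `f(x, ·) → ±½`, and `U_B = burgersLayerProfile 1 ν 1`
(`ν > 0`): there are a rate `0 < k′ ≤ k` (`k′ = min k κ`) and a constant `D ≥ max(1, C + 1)` such that
`a = f − U_B` is `C²` with `∂ₓa = ∂ₓf`, `∂_ya = ∂_yf − U_B′`, `Δa = Δf − U_B″`, and
`|a|, |∂_yf − U_B′|, |Δf − U_B″| ≤ D e^{−k′|y|}`, `|U_B′| ≤ D`, `e^{−k|y|} ≤ e^{−k′|y|}`
(`energyRelam_shear_decay` for `f(x, ·)` and the Gaussian tails of `U_B`). [folklore] -/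
theorem energyRelam_perturbation {ν C k : ℝ} {f g : ℝ → ℝ → ℝ} (hν : 0 < ν) (hk : 0 < k)
    (hf : ContDiff ℝ 2 (fun q : ℝ × ℝ => f q.1 q.2)) (hT : SliceTails C k f g)
    (htop : ∀ x, Tendsto (fun y => f x y) atTop (𝓝 (1 / 2)))
    (hbot : ∀ x, Tendsto (fun y => f x y) atBot (𝓝 (-(1 / 2)))) :
    ∃ k' D : ℝ, 0 < k' ∧ k' ≤ k ∧ C + 1 ≤ D ∧ 1 ≤ D ∧
      ContDiff ℝ 2 (fun q : ℝ × ℝ => f q.1 q.2 - burgersLayerProfile 1 ν 1 q.2) ∧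
      (∀ x y, dX (fun x y => f x y - burgersLayerProfile 1 ν 1 y) x y = dX f x y) ∧
      (∀ x y, dY (fun x y => f x y - burgersLayerProfile 1 ν 1 y) x y =
        dY f x y - burgersLayerProfileD 1 ν 1 y) ∧
      (∀ x y, lap (fun x y => f x y - burgersLayerProfile 1 ν 1 y) x y =
        lap f x y - burgersLayerProfileDD 1 ν 1 y) ∧
      (∀ y, Real.exp (-k * |y|) ≤ Real.exp (-k' * |y|)) ∧
      (∀ x y, |f x y - burgersLayerProfile 1 ν 1 y| ≤ D * Real.exp (-k' * |y|)) ∧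
      (∀ x y, |dY f x y - burgersLayerProfileD 1 ν 1 y| ≤ D * Real.exp (-k' * |y|)) ∧
      (∀ x y, |lap f x y - burgersLayerProfileDD 1 ν 1 y| ≤ D * Real.exp (-k' * |y|)) ∧
      (∀ y, |burgersLayerProfileD 1 ν 1 y| ≤ D) := by
  obtain ⟨hκ, -, hD0, -, -, cB, hcB1, hcB⟩ := energyRelam_profile hν
  set κ := burgersLayerRate 1 ν with hκ_def
  set UB := burgersLayerProfile 1 ν 1 with hUB_def
  set UB' := burgersLayerProfileD 1 ν 1 with hUB'_def
  set UB'' := burgersLayerProfileDD 1 ν 1 with hUB''_def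
  have hC : 0 ≤ C := hT.nonneg
  have hf1 : ContDiff ℝ 1 (fun q : ℝ × ℝ => f q.1 q.2) := hf.of_le one_le_two
  -- the common rate
  set k' : ℝ := min k κ with hk'_def
  have hk' : 0 < k' := lt_min hk hκ
  have hk'k : k' ≤ k := min_le_left _ _
  have hk'κ : k' ≤ κ := min_le_right _ _
  have hek : ∀ y, Real.exp (-k * |y|) ≤ Real.exp (-k' * |y|) := fun y =>
    Real.exp_le_exp.2 (by nlinarith [abs_nonneg y])
  have heκ : ∀ y, Real.exp (-κ * |y|) ≤ Real.exp (-k' * |y|) := fun y =>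
    Real.exp_le_exp.2 (by nlinarith [abs_nonneg y])
  have he0 : ∀ y, 0 < Real.exp (-k' * |y|) := fun y => Real.exp_pos _
  -- the profile as a plane field and the slice derivatives of the perturbation
  have hU2 : ContDiff ℝ 2 (fun q : ℝ × ℝ => UB q.2) := (contDiff_two_burgersLayerProfile 1 ν 1).comp contDiff_snd
  have ha2 : ContDiff ℝ 2 (fun q : ℝ × ℝ => f q.1 q.2 - UB q.2) := hf.sub hU2
  have hXa : ∀ x y, dX (fun x y => f x y - UB y) x y = dX f x y := fun x y => by
    simp only [dX, deriv_sub_const]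
  have hYa : ∀ x y, dY (fun x y => f x y - UB y) x y = dY f x y - UB' y := fun x y =>
    ((hasDerivAt_dY_of_contDiff hf two_ne_zero x y).sub (hasDerivAt_burgersLayerProfile' 1 ν 1 y)).deriv
  have hXXa : ∀ x y, dX (dX (fun x y => f x y - UB y)) x y = dX (dX f) x y := fun x y => by
    have e : dX (fun x y => f x y - UB y) = dX f := funext fun x => funext fun y => hXa x y
    rw [e]
  have hYYa : ∀ x y, dY (dY (fun x y => f x y - UB y)) x y = dY (dY f) x y - UB'' y := fun x y => by
    have e : dY (fun x y => f x y - UB y) = fun x y => dY f x y - UB' y :=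
      funext fun x => funext fun y => hYa x y
    rw [e]
    exact ((hasDerivAt_dY_of_contDiff (contDiff_one_dY hf) one_ne_zero x y).sub
      (hasDerivAt_burgersLayerProfileD 1 ν 1 y)).deriv
  have hLa : ∀ x y, lap (fun x y => f x y - UB y) x y = lap f x y - UB'' y := fun x y => by
    rw [lap_apply, lap_apply, hXXa, hYYa]; ring
  -- shear decay of `f − U_B`
  have hstep : ∀ x y, |f x y - (if 0 ≤ y then 1 / 2 else -(1 / 2))| ≤ C / k * Real.exp (-k * |y|) :=
    fun x => energyRelam_shear_decay hk (hasDerivAt_dY_of_contDiff hf two_ne_zero x)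
      (continuous_slice_y (continuous_dY hf1) x) (fun y => hT.abs_dY_u_le x y) (htop x) (hbot x)
  have hCk : 0 ≤ C / k := div_nonneg hC hk.le
  set D : ℝ := C / k + cB + C + 1 with hD_def
  refine ⟨k', D, hk', hk'k, by simp only [hD_def]; linarith, by simp only [hD_def]; linarith, ha2, hXa, hYa,
    hLa, hek, fun x y => ?_, fun x y => ?_, fun x y => ?_, fun y => ?_⟩
  · have h1 := hstep x y
    have h2 := (hcB y).2.2.2
    have e : f x y - UB y = (f x y - (if 0 ≤ y then 1 / 2 else -(1 / 2))) -
        (UB y - (if 0 ≤ y then 1 / 2 else -(1 / 2))) := by ring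
    rw [e]
    refine (abs_sub _ _).trans ?_
    have h3 := mul_le_mul_of_nonneg_left (hek y) hCk
    have h4 := mul_le_mul_of_nonneg_left (heκ y) (by linarith : 0 ≤ cB)
    have h5 : (C / k + cB) * Real.exp (-k' * |y|) ≤ D * Real.exp (-k' * |y|) :=
      mul_le_mul_of_nonneg_right (by simp only [hD_def]; linarith) (he0 y).le
    linarith
  · have h1 := hT.abs_dY_u_le x y
    have h2 := (hcB y).2.1
    refine (abs_sub _ _).trans ?_
    rw [abs_of_nonneg (hD0 y)]
    have h3 := mul_le_mul_of_nonneg_left (hek y) hC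
    have h4 := mul_le_mul_of_nonneg_left (heκ y) (by linarith : 0 ≤ cB)
    have h5 : (C + cB) * Real.exp (-k' * |y|) ≤ D * Real.exp (-k' * |y|) :=
      mul_le_mul_of_nonneg_right (by simp only [hD_def]; linarith) (he0 y).le
    linarith
  · have h1 := hT.abs_lap_u_le x y
    have h2 := (hcB y).2.2.1
    refine (abs_sub _ _).trans ?_
    have h3 := mul_le_mul_of_nonneg_left (hek y) hC
    have h4 := mul_le_mul_of_nonneg_left (heκ y) (by linarith : 0 ≤ cB)
    have h5 : (C + cB) * Real.exp (-k' * |y|) ≤ D * Real.exp (-k' * |y|) :=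
      mul_le_mul_of_nonneg_right (by simp only [hD_def]; linarith) (he0 y).le
    linarith
  · rw [abs_of_nonneg (hD0 y)]
    have := (hcB y).1
    simp only [hD_def]
    linarith

/-! ## The pressure of a tailed slice -/

/-- **Pressure bookkeeping of a tailed classical solution** at a time `t > 0` with shear tails
`SliceTails C k (u t) (v t)` and time derivatives `≤ Ce^{−k|y|}`: read off the momentum equations, `∂ₓp` decays like
`(1 + |y|)²e^{−k|y|}`, `∂_yp` grows at most linearly and `p` (periodic in `x`) at most quadratically across the
layer — one constant `Q ≥ 0` for the three (as inside `stub_strainWorkIdentity_slice`). [folklore] -/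
theorem energyRelam_pressure : ∀ (ν L t C k : ℝ) (u v p : ℝ → ℝ → ℝ → ℝ), 0 < L → 0 < t → 0 < k →
    IsStretchedLayerNSSolutionOn (Ioi 0) ν 1 1 L u v p → SliceTails C k (u t) (v t) →
    (∀ x y, |deriv (fun s => u s x y) t| + |deriv (fun s => v s x y) t| ≤ C * Real.exp (-k * |y|)) →
      ∃ Q : ℝ, 0 ≤ Q ∧ ∀ x y, |p t x y| ≤ Q * (1 + |y|) ^ 2 ∧
        |dX (p t) x y| ≤ Q * ((1 + |y|) ^ 2 * Real.exp (-k * |y|)) ∧ |dY (p t) x y| ≤ Q * (1 + |y|) := by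
  intro ν L t C k u v p hL ht hk h hST hT
  have ht' : t ∈ Ioi (0:ℝ) := ht
  have hC : 0 ≤ C := hST.nonneg
  have he1 : ∀ y : ℝ, Real.exp (-k * |y|) ≤ 1 := exp_neg_mul_abs_le_one hk
  -- atomic bounds at time `t`
  have hu : ∀ x y, |u t x y| ≤ 1 + C := hST.abs_u_le hk
  have hvC : ∀ x y, |v t x y| ≤ C := hST.abs_v_le_const hk
  have hux : ∀ x y, |dX (u t) x y| ≤ C * Real.exp (-k * |y|) := hST.abs_dX_u_le
  have huy : ∀ x y, |dY (u t) x y| ≤ C * Real.exp (-k * |y|) := hST.abs_dY_u_le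
  have hvx : ∀ x y, |dX (v t) x y| ≤ C * Real.exp (-k * |y|) := hST.abs_dX_v_le
  have hvy : ∀ x y, |dY (v t) x y| ≤ C * Real.exp (-k * |y|) := hST.abs_dY_v_le
  have hlu : ∀ x y, |lap (u t) x y| ≤ C * Real.exp (-k * |y|) := hST.abs_lap_u_le
  have hlv : ∀ x y, |lap (v t) x y| ≤ C * Real.exp (-k * |y|) := hST.abs_lap_v_le
  have hut : ∀ x y, |deriv (fun s => u s x y) t| ≤ C * Real.exp (-k * |y|) := fun x y => by
    linarith [hT x y, abs_nonneg (deriv (fun s => v s x y) t)]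
  have hvt : ∀ x y, |deriv (fun s => v s x y) t| ≤ C * Real.exp (-k * |y|) := fun x y => by
    linarith [hT x y, abs_nonneg (deriv (fun s => u s x y) t)]
  have hleC : ∀ {z : ℝ} {y : ℝ}, |z| ≤ C * Real.exp (-k * |y|) → |z| ≤ C := fun hz =>
    hz.trans (mul_le_of_le_one_right hC (he1 _))
  have hp1 := h.contDiff_p ht'
  have cp : Continuous (fun q : ℝ × ℝ => p t q.1 q.2) := hp1.continuous
  -- the momentum equations with the two-sided time derivative
  have hmx : ∀ x y, deriv (fun s => u s x y) t + u t x y * dX (u t) x y +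
      (v t x y - 1 * y) * dY (u t) x y = -dX (p t) x y + ν * lap (u t) x y := fun x y => by
    have e := h.momentum_x t ht' x y
    rwa [dT_of_isOpen isOpen_Ioi u ht'] at e
  have hmy : ∀ x y, deriv (fun s => v s x y) t + u t x y * dX (v t) x y +
      (v t x y - 1 * y) * dY (v t) x y - 1 * v t x y = -dY (p t) x y + ν * lap (v t) x y := fun x y => by
    have e := h.momentum_y t ht' x y
    rwa [dT_of_isOpen isOpen_Ioi v ht'] at e
  -- the pressure gradient
  set K : ℝ := 2 * C + (1 + C) * C + (C + 1) * C + |ν| * C with hK_def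
  have hK0 : 0 ≤ K := by positivity
  have hvy1 : ∀ x y, |v t x y - 1 * y| ≤ (C + 1) * (1 + |y|) := fun x y => by
    have h1 := abs_sub_mul_le_linear (γ := 1) y hC (hvC x y)
    rwa [abs_one] at h1
  have hpx : ∀ x y, |dX (p t) x y| ≤ K * ((1 + |y|) ^ 2 * Real.exp (-k * |y|)) := by
    intro x y
    have e : dX (p t) x y = -deriv (fun s => u s x y) t - u t x y * dX (u t) x y -
        (v t x y - 1 * y) * dY (u t) x y + ν * lap (u t) x y := by linarith [hmx x y]
    rw [e]
    set E : ℝ := Real.exp (-k * |y|) with hE_def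
    set W : ℝ := (1 + |y|) ^ 2 * Real.exp (-k * |y|) with hW_def
    have w1 : E ≤ W := exp_le_one_add_abs_sq_mul_exp k y
    have w2 : (1 + |y|) * E ≤ W := one_add_abs_mul_exp_le_sq k y
    have i0 : |-deriv (fun s => u s x y) t| ≤ C * E := by rw [abs_neg]; exact hut x y
    have i1 : |u t x y * dX (u t) x y| ≤ (1 + C) * (C * E) := by
      rw [abs_mul]; exact mul_le_mul (hu x y) (hux x y) (abs_nonneg _) (by linarith)
    have i2 : |(v t x y - 1 * y) * dY (u t) x y| ≤ (C + 1) * (1 + |y|) * (C * E) := by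
      rw [abs_mul]; exact mul_le_mul (hvy1 x y) (huy x y) (abs_nonneg _) (by positivity)
    have i3 : |ν * lap (u t) x y| ≤ |ν| * (C * E) := by
      rw [abs_mul]; exact mul_le_mul_of_nonneg_left (hlu x y) (abs_nonneg ν)
    have j0 := mul_le_mul_of_nonneg_left w1 hC
    have j1 := mul_le_mul_of_nonneg_left w1 (by positivity : 0 ≤ (1 + C) * C)
    have j2 := mul_le_mul_of_nonneg_left w2 (by positivity : 0 ≤ (C + 1) * C)
    have j3 := mul_le_mul_of_nonneg_left w1 (by positivity : 0 ≤ |ν| * C)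
    calc _ ≤ |-deriv (fun s => u s x y) t - u t x y * dX (u t) x y -
          (v t x y - 1 * y) * dY (u t) x y| + |ν * lap (u t) x y| := abs_add_le _ _
      _ ≤ |-deriv (fun s => u s x y) t - u t x y * dX (u t) x y| +
          |(v t x y - 1 * y) * dY (u t) x y| + |ν * lap (u t) x y| := by
          gcongr; exact abs_sub _ _
      _ ≤ |-deriv (fun s => u s x y) t| + |u t x y * dX (u t) x y| +
          |(v t x y - 1 * y) * dY (u t) x y| + |ν * lap (u t) x y| := by
          gcongr; exact abs_sub _ _
      _ ≤ C * E + (1 + C) * (C * E) + (C + 1) * (1 + |y|) * (C * E) + |ν| * (C * E) := by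
          gcongr
      _ ≤ C * W + (1 + C) * C * W + (C + 1) * C * W + |ν| * C * W := by linarith
      _ ≤ K * W := by
          rw [hK_def]
          have hW0 : 0 ≤ W := by positivity
          nlinarith
  have hpy : ∀ x y, |dY (p t) x y| ≤ K * (1 + |y|) := by
    intro x y
    have e : dY (p t) x y = -deriv (fun s => v s x y) t - u t x y * dX (v t) x y -
        (v t x y - 1 * y) * dY (v t) x y + 1 * v t x y + ν * lap (v t) x y := by linarith [hmy x y]
    rw [e]
    have i0 : |-deriv (fun s => v s x y) t| ≤ C := by rw [abs_neg]; exact hleC (hvt x y)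
    have i1 : |u t x y * dX (v t) x y| ≤ (1 + C) * C := by
      rw [abs_mul]; exact mul_le_mul (hu x y) (hleC (hvx x y)) (abs_nonneg _) (by linarith)
    have i2 : |(v t x y - 1 * y) * dY (v t) x y| ≤ (C + 1) * (1 + |y|) * C := by
      rw [abs_mul]; exact mul_le_mul (hvy1 x y) (hleC (hvy x y)) (abs_nonneg _) (by positivity)
    have i3 : |1 * v t x y| ≤ C := by rw [one_mul]; exact hvC x y
    have i4 : |ν * lap (v t) x y| ≤ |ν| * C := by
      rw [abs_mul]; exact mul_le_mul_of_nonneg_left (hleC (hlv x y)) (abs_nonneg ν)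
    have hy := abs_nonneg y
    calc _ ≤ |-deriv (fun s => v s x y) t - u t x y * dX (v t) x y -
          (v t x y - 1 * y) * dY (v t) x y + 1 * v t x y| + |ν * lap (v t) x y| := abs_add_le _ _
      _ ≤ |-deriv (fun s => v s x y) t - u t x y * dX (v t) x y -
          (v t x y - 1 * y) * dY (v t) x y| + |1 * v t x y| + |ν * lap (v t) x y| := by
          gcongr; exact abs_add_le _ _
      _ ≤ |-deriv (fun s => v s x y) t - u t x y * dX (v t) x y| +
          |(v t x y - 1 * y) * dY (v t) x y| + |1 * v t x y| + |ν * lap (v t) x y| := by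
          gcongr; exact abs_sub _ _
      _ ≤ |-deriv (fun s => v s x y) t| + |u t x y * dX (v t) x y| +
          |(v t x y - 1 * y) * dY (v t) x y| + |1 * v t x y| + |ν * lap (v t) x y| := by
          gcongr; exact abs_sub _ _
      _ ≤ C + (1 + C) * C + (C + 1) * (1 + |y|) * C + C + |ν| * C := by gcongr
      _ ≤ K * (1 + |y|) := by
          rw [hK_def]
          nlinarith [mul_nonneg hC hy, mul_nonneg (mul_nonneg hC hC) hy,
            mul_nonneg (mul_nonneg (abs_nonneg ν) hC) hy]
  -- the pressure grows at most quadratically across the layer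
  obtain ⟨M₀, hM₀⟩ := exists_abs_le_of_periodic (g := fun x => p t x 0) hL (continuous_slice_x cp 0)
    (fun x => h.periodic_p t ht' x 0)
  have hM₀0 : 0 ≤ M₀ := (abs_nonneg _).trans (hM₀ 0)
  have hP : ∀ x y, |p t x y| ≤ (M₀ + K) * (1 + |y|) ^ 2 := by
    intro x y
    have hmv := abs_sub_zero_le_of_abs_deriv_le (g := fun s => p t x s)
      (fun s => (hasDerivAt_dY_of_contDiff hp1 one_ne_zero x s).differentiableAt)
      (fun s => hpy x s) y
    have h0 := hM₀ x
    have hy := abs_nonneg y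
    calc |p t x y| ≤ |p t x 0| + |p t x y - p t x 0| := by
          have h3 := abs_add_le (p t x 0) (p t x y - p t x 0)
          rwa [add_sub_cancel] at h3
      _ ≤ M₀ + K * (1 + |y|) * |y| := add_le_add h0 hmv
      _ ≤ (M₀ + K) * (1 + |y|) ^ 2 := by nlinarith [mul_nonneg hK0 hy, mul_nonneg hM₀0 hy]
  refine ⟨M₀ + K, by positivity, fun x y => ⟨hP x y, ?_, ?_⟩⟩
  · exact (hpx x y).trans (mul_le_mul_of_nonneg_right (by linarith) (by positivity))
  · exact (hpy x y).trans (mul_le_mul_of_nonneg_right (by linarith) (by positivity))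

end Summit.AnomalousDissipation.AnomalousDissipation.Theorems.StrainedLayerLaw.LogEnstrophyClock

end
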